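import Mathlib.Tactic
import HarnessLib

/-!
# T3.6 arm M′ of the stub-critic's STUB-PLAN v2.8 for `stub_heegnerIndexLowerAtTwo` (crux `PrintCf2.SplitBadTwoLowerHalfOfFacts`,
# stmt-BirchSwinnertonDyer-27851): RELATIVE (algebraic, kit-free) CALIBRATION of the LOWER chain at one BSD₂-known anchor —
# FLOOR form, with the T1⁻ cofactor made explicit

Scratch certificate of seat `scrit-stub_heegnerIndexLowerAtTwo` g13 (planner, stub-critic; NOT a proposal — published as a crux
workfile and attached as evidence). THEOREMS ONLY over `ℤ` (valuation shadow), no `sorry`, no definitions, no named facts,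
nothing asserted about BSD. It is the critic's sharpening of card k1-g10 (sidea-1 g10, `STUB_IDEAS_…_1_g10.lean`
`armM_member_bound`): the card's four CLASS-CONSTANCY hypotheses (`e_A, e_M, t, k` key-rigid) are weakened to the two
ONE-SIDED extremality hypotheses the assembly actually consumes —

* (F-A) the anchor MINIMISES the analytic offset on its class: `e_A(W₀) ≤ e_A(W)` (= k1-g9's floor `SemiRigidBelow`, row 26);
* (C-M) the anchor MAXIMISES the algebraic offset on its class: `e_M(W) ≤ e_M(W₀)`;

and the card's anchor hypothesis «ES-direction of the main conjecture at `W₀` with the SAME `e_M`» (its K2) is replaced by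
what road T1⁻ (Δ-sandwich, STUB-PLAN §3 (v)) actually delivers at every member INCLUDING the anchor: an equality up to an
explicit cofactor, `2n = m − e + ρ + 2ε + 2σ` with `e` the normalisation digit (R2c-iv′), `ρ` the plus-branch (sister `E₀`)
defect at `T = 0` — ONE global constant —, `ε ≥ 0` the sandwich's 2-torsion defect (`ε ≤ μ(Y_W) = 0` by Müller 2020
Thm 3.21 [arXiv:2002.05647 p. 13]: `X^{(𝔭)}(𝕂_∞𝕄)` is finitely generated over `ℤ₂` for ANY abelian `𝕄/𝕂`) and `σ ≥ 0` the
elliptic-unit generation defect of (INT)_tot / R2c^⊆ at level `𝔣_W`. Then (`es_at_anchor_of_cofactor`, `mc_at_member_of_cofactor`)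
the member containment holds with the SHIFTED constant `e − ρ − 2σ`, the anchor's ES-direction holds with `e − ρ − 2σ₀` iff
`ε₀ = 0`, and (C-M) reads `σ₀ ≤ σ` (`ceiling_iff_generation_monotone`): arm M′ touches R2c-iv′ / R39 only through the
MONOTONICITY (or constancy) of the generation defect, never through its value. No Euler-system input anywhere.

Directions (B1 of the battery): every anchor digit enters through its CONSTRUCTIVE half — `b₀` and `c₀` need LOWER bounds
(exhibit classes of `𝔖_{v̄}(K₀, W₀*)` and `Γ`-fixed classes over `K*_∞` not from `K₀`), `φ₀ = v₂ #𝔖_Γ` an UPPER bound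
(`φ₀ = 0` ⟸ `X(W₀)` cyclic, since `Λ/(f)`, `f ≠ 0`, has no non-zero finite submodule — Greenberg LNM 1716 p. 127 — or B17ᴸ at
`W₀`), `kk₀ = v₂ #ker(control) = 0` is landed under (H7) (`ker_control_of_frame_eq_bot`), BSD₂ at `W₀` is Miller's theorem at
N ∈ {784, 3136} (rung R-1) moved to `K₀` by Milne 1972 + isogeny invariance (conjuncts of the stub's hypotheses).
References: card k1-g10; STUB-PLAN v2.8 §1 row 29, §3 (vii), §4 T3.6 arm M′; K. Müller, arXiv:2002.05647 Thm 3.21;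
R. Greenberg, LNM 1716 (1999) pp. 110, 124–127 [GreenbergLNM1716]; A. Agboola, Compositio 143 (2007) Prop. 5.1 [Agboola2007].
-/

namespace Summit.BirchSwinnertonDyer.BirchSwinnertonDyer.Cruxes.SplitBadTwoLowerHalfOfFacts.StubPlanT3ArmMPrime

/-- Road T1⁻ at a MEMBER: the sandwich equality-up-to-cofactor `2n = m − e + ρ + 2ε + 2σ` with `ε, σ ≥ 0`... only `ε ≥ 0`
is dropped here; `σ` is kept inside the shifted constant `e − ρ − 2σ` (it is compared with the anchor's `σ₀` later). -/
theorem mc_at_member_of_cofactor {m n e ρ ε σ : ℤ} (hT1 : 2 * n = m - e + ρ + 2 * ε + 2 * σ) (hε : 0 ≤ ε) :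
    m ≤ 2 * n + (e - ρ - 2 * σ) := by
  omega

/-- Road T1⁻ at the ANCHOR: the ES-direction «`2n₀ + e_M ≤ m₀`» with the shifted constant `e − ρ − 2σ₀` holds iff the
anchor's 2-torsion defect vanishes — `ε₀ = 0`, i.e. `μ(Y_{W₀}) = 0` (Müller 2020 Thm 3.21, print). No Euler system. -/
theorem es_at_anchor_of_cofactor {m₀ n₀ e ρ ε₀ σ₀ : ℤ} (hT1 : 2 * n₀ = m₀ - e + ρ + 2 * ε₀ + 2 * σ₀) (hε₀ : ε₀ = 0) :
    2 * n₀ + (e - ρ - 2 * σ₀) ≤ m₀ := by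
  omega

theorem es_at_anchor_iff_torsionDefect_zero {m₀ n₀ e ρ ε₀ σ₀ : ℤ} (hT1 : 2 * n₀ = m₀ - e + ρ + 2 * ε₀ + 2 * σ₀) :
    2 * n₀ + (e - ρ - 2 * σ₀) ≤ m₀ ↔ ε₀ ≤ 0 := by
  omega

/-- (C-M) «the anchor maximises the algebraic offset» is, on road T1⁻, exactly the MONOTONICITY of the elliptic-unit
generation defect: `σ₀ ≤ σ` (automatic if R2c-iv′'s digit is key-constant; plausible in general because the anchors
`d₀ ∈ {−1, 2, −2}` have the minimal level in their class). -/
theorem ceiling_iff_generation_monotone {e ρ σ σ₀ : ℤ} :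
    e - ρ - 2 * σ ≤ e - ρ - 2 * σ₀ ↔ σ₀ ≤ σ := by
  omega

/-- ARM M′, FLOOR FORM. Member: S2′ shape, containment, one-sided control, bottom and cokernel tables. Anchor: S2′ shape,
ES-direction (from `es_at_anchor_of_cofactor`), the EXACT four-term control identity (landed, p652120), BSD₂ (Miller, R-1).
Class: (F-A) `e_A(W₀) ≤ e_A(W)` and (C-M) `e_M(W) ≤ e_M(W₀)`. Conclusion: `A ≤ B₁ + Δ₀` with the anchor's total descent
defect `Δ₀ = φ₀ + kk₀ + (B₀ + t − b₀) + (k − c₀)` — the card's `armM_member_bound` with constancy weakened to extremality. -/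
theorem armMprime_member_bound {A B₁ m n b c t k eA eM A₀ B₀ m₀ n₀ b₀ c₀ φ₀ kk₀ eA₀ eM₀ : ℤ}
    (hS2 : m = 2 * A + eA) (hMC : m ≤ 2 * n + eM) (hctl : n ≤ b + c) (hbot : b ≤ B₁ + t) (hcok : c ≤ k)
    (hS2₀ : m₀ = 2 * A₀ + eA₀) (hES₀ : 2 * n₀ + eM₀ ≤ m₀) (hctl₀ : n₀ + φ₀ + kk₀ = b₀ + c₀) (hBSD₀ : A₀ = B₀)
    (hflA : eA₀ ≤ eA) (hceM : eM ≤ eM₀) :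
    A ≤ B₁ + (φ₀ + kk₀ + (B₀ + t - b₀) + (k - c₀)) := by
  omega

/-- END TO END on road T1⁻ (cofactor form at member and anchor; `ε ≥ 0` at the member, `ε₀ = 0` at the anchor; the same
normalisation digit `e` and plus-defect `ρ` on the class; generation defect monotone `σ₀ ≤ σ`; analytic floor `eA₀ ≤ eA`). -/
theorem armMprime_of_T1minus {A B₁ m n b c t k eA A₀ B₀ m₀ n₀ b₀ c₀ φ₀ kk₀ eA₀ e ρ ε σ ε₀ σ₀ : ℤ}
    (hS2 : m = 2 * A + eA) (hT1 : 2 * n = m - e + ρ + 2 * ε + 2 * σ) (hε : 0 ≤ ε)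
    (hctl : n ≤ b + c) (hbot : b ≤ B₁ + t) (hcok : c ≤ k)
    (hS2₀ : m₀ = 2 * A₀ + eA₀) (hT1₀ : 2 * n₀ = m₀ - e + ρ + 2 * ε₀ + 2 * σ₀) (hε₀ : ε₀ = 0)
    (hctl₀ : n₀ + φ₀ + kk₀ = b₀ + c₀) (hBSD₀ : A₀ = B₀)
    (hflA : eA₀ ≤ eA) (hσ : σ₀ ≤ σ) :
    A ≤ B₁ + (φ₀ + kk₀ + (B₀ + t - b₀) + (k - c₀)) :=
  armMprime_member_bound hS2 (mc_at_member_of_cofactor hT1 hε) hctl hbot hcok hS2₀ (es_at_anchor_of_cofactor hT1₀ hε₀)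
    hctl₀ hBSD₀ hflA ((ceiling_iff_generation_monotone).2 hσ)

/-- The budget: `Δ₀ ≤ 1` plus parity (W0 / Cassels–Tate in the doubled `K`-currency makes `A − B₁` even) closes LOWER. -/
theorem lower_of_defect_le_one {A B₁ Δ₀ : ℤ} (h : A ≤ B₁ + Δ₀) (hΔ : Δ₀ ≤ 1) (hpar : Even (A - B₁)) : A ≤ B₁ := by
  obtain ⟨r, hr⟩ := hpar
  omega

/-- `Δ₀ = 0` closes LOWER with no parity input. -/
theorem lower_of_defect_zero {A B₁ Δ₀ : ℤ} (h : A ≤ B₁ + Δ₀) (hΔ : Δ₀ ≤ 0) : A ≤ B₁ := by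
  omega

/-- SHARPNESS of the floor form: with every hypothesis of `armMprime_member_bound` an equality except the two floors, the
member gap is `Δ₀ − Δ(W) − (floor slacks)/2`; in particular the bound `A ≤ B₁ + Δ₀` is attained (all slacks zero). -/
theorem armMprime_sharp : ∃ A B₁ m n b c t k eA eM A₀ B₀ m₀ n₀ b₀ c₀ φ₀ kk₀ eA₀ eM₀ : ℤ,
    m = 2 * A + eA ∧ m ≤ 2 * n + eM ∧ n ≤ b + c ∧ b ≤ B₁ + t ∧ c ≤ k ∧
    m₀ = 2 * A₀ + eA₀ ∧ 2 * n₀ + eM₀ ≤ m₀ ∧ n₀ + φ₀ + kk₀ = b₀ + c₀ ∧ A₀ = B₀ ∧ eA₀ ≤ eA ∧ eM ≤ eM₀ ∧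
    A = B₁ + (φ₀ + kk₀ + (B₀ + t - b₀) + (k - c₀)) ∧ φ₀ + kk₀ + (B₀ + t - b₀) + (k - c₀) = 1 := by
  refine ⟨1, 0, 2, 1, 1, 0, 1, 0, 0, 0, 0, 0, 0, 0, 1, 0, 1, 0, 0, 0, ?_⟩
  norm_num

/-- WHAT THE KIT WOULD READ (R66 (iii) as a CROSS-CHECK, not an input): under the anchor equalities the Katz value
`m₀ = 2g₀` equals `2(B₀ + t + k) + eM₀ − 2Δ₀` — one number, TWO unknowns (`eM₀` = the shifted normalisation constant,
`Δ₀` = the descent defect); given the finite digits it calibrates R2c-iv′'s constant numerically, and conversely. -/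
theorem kit_reads_constant_sub_twice_defect {B₀ t k m₀ n₀ b₀ c₀ φ₀ kk₀ eM₀ : ℤ}
    (hMC₀ : m₀ = 2 * n₀ + eM₀) (hctl₀ : n₀ + φ₀ + kk₀ = b₀ + c₀) :
    m₀ = 2 * (B₀ + t + k) + eM₀ - 2 * (φ₀ + kk₀ + (B₀ + t - b₀) + (k - c₀)) := by
  omega

/-- CONTRAST (the card's `containment_only_does_not_calibrate`, kept): with CONTAINMENT at the anchor instead of the
ES-direction nothing bounds `A` — the floor form does not rescue it. -/
theorem containment_only_does_not_calibrate_floor : ∃ A B₁ m n b c t k eA eM A₀ B₀ m₀ n₀ b₀ c₀ φ₀ kk₀ eA₀ eM₀ : ℤ,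
    m = 2 * A + eA ∧ m ≤ 2 * n + eM ∧ n ≤ b + c ∧ b ≤ B₁ + t ∧ c ≤ k ∧
    m₀ = 2 * A₀ + eA₀ ∧ m₀ ≤ 2 * n₀ + eM₀ ∧ n₀ + φ₀ + kk₀ = b₀ + c₀ ∧ A₀ = B₀ ∧ eA₀ ≤ eA ∧ eM ≤ eM₀ ∧
    φ₀ = 0 ∧ kk₀ = 0 ∧ b₀ = B₀ + t ∧ c₀ = k ∧ A = B₁ + 100 := by
  refine ⟨100, 0, 200, 0, 0, 0, 0, 0, 0, 200, 0, 0, 0, 0, 0, 0, 0, 0, 0, 200, ?_⟩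
  norm_num

end Summit.BirchSwinnertonDyer.BirchSwinnertonDyer.Cruxes.SplitBadTwoLowerHalfOfFacts.StubPlanT3ArmMPrime
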